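import Mathlib.MeasureTheory.Measure.Prod
import Mathlib.MeasureTheory.Measure.Count
import Summits.QuantumFields.QCD.Theorems.QuarksAsStableActionStableActionBridgeStubModeNumberSelection
import Summits.QuantumFields.QCD.Theorems.QuarksAsStableActionStableActionBridgeFermionSlicePosDef
import HarnessLib

/-!
# Stub `stub_wave_sector` of line `twisted_trace_transfer`
# for crux `QuarksAsStableAction.StableActionBridge` (item stmt-QuantumFields-9737)

This file proves the registered stub `stub_wave_sector` (sub-goal W7a of step E3 of the lead skeleton
of line `twisted_trace_transfer`, `--supports stmt-QuantumFields-9737`): **an eigenwave of the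
transfer map that vanishes `Haar ⊗ count`-a.e. off a mode-number sector after multiplication by the
square root `R` of `T̂_F` vanishes EVERYWHERE off that sector** (and `R` itself preserves sectors).

Setting (E3).  `X = SU(3)^{E₃}` carries the product Haar probability `μ = sliceHaar S`,
`F = Finset (modes)` is the occupation basis of the slice Fock space, `T̂_F(U) = fermionSliceOp U mq`,
`R(U)` is a Hermitian square root of `T̂_F(U)` in the bicommutant of `T̂_F(U)`, and
`B(U,U')_{a c} = ∫ K_β(U,U'^g) Γ(G_g)_{a c} dg` is the Gauss-averaged Wilson bond kernel; the transfer
map is `(𝒯Ψ)(U) = ∫ B(U,U') T̂_F(U') Ψ(U') dμ(U')`.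

## Proof

* Mode-number conservation.  `T̂_F(U) = det² · Γ(M_F(U))` and `Γ(G_g)` have vanishing entries
  between `s, t` with `#s ≠ #t` (`fockLift_apply_of_card_ne`), i.e. they commute with the mode-number
  operator `diag(#s)` (`diagonal_mul_eq_mul_diagonal_iff`, `modeNumber_comm_fermionSliceOp`); hence so
  does `R(U)` (bicommutant) and `B(U,U')` (entrywise under the `dg`-integral).  A matrix `M` with
  `M_{st} = 0` for `#s ≠ #t` maps vectors supported where `p(#s)` holds to such vectors, for ANY
  predicate `p` (`mulVec_apply_eq_zero_of_sector`); with `p = (· ≠ m)` this is clause (i).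
* (ii), step A.  A `μ ⊗ count`-null set has `μ`-null `s`-sections for every `s`
  (`Measure.ae_ae_of_ae_prod`, `Measure.ae_count_iff`): for `μ`-a.e. `U`, `(R(U)Ψ(U))_s = 0` for ALL
  `#s ≠ n₀`.
* Step B.  `R(U)` is invertible (`R(U)² = T̂_F(U) > 0`, `fermionSliceOp_posDef`, so `det R(U) ≠ 0`)
  and sector preserving; writing `Ψ(U) = v_on + v_off` (on/off the sector `n₀`), `R v_off` vanishes on
  the sector (sector preservation) and off it (`= R Ψ(U) − R v_on`, both zero there), so `R v_off = 0`
  and `v_off = 0` (`Matrix.eq_zero_of_mulVec_eq_zero`): for `μ`-a.e. `U`, `Ψ(U)_s = 0` for all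
  `#s ≠ n₀`.
* Step C (a.e. ⇒ everywhere).  For ANY `U` and `#a ≠ n₀`, `λ Ψ(U)_a = ∫ (B(U,U') T̂_F(U') Ψ(U'))_a dμ(U')`;
  the matrix `B(U,U') T̂_F(U')` conserves `#s`, so by step B the integrand vanishes for `μ`-a.e. `U'`,
  the integral is `0`, and `Ψ(U)_a = 0` as `λ ≠ 0`.  (Continuity of `R` and `Ψ` is not needed.)

The analysis is done for abstract data (sub-namespace `StubWaveSector`: a measure space `X`, a
finite index type `F` with a "mode number" `n : F → α`, matrices `R, T, B`) and instantiated at the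
end.  Pure theorem file (no definitions, no local notations).

References: M. Lüscher, Commun. Math. Phys. 54 (1977) 283 [Luscher1977, pp. 283–292]; J. Smit,
*Introduction to Quantum Fields on a Lattice* [Smit2023, §4.6 (4.125)–(4.127), §6.5 (6.87)–(6.91)].
-/

noncomputable section

open MeasureTheory Filter
open scoped InnerProductSpace ComplexConjugate Matrix BigOperators ComplexOrder
open Literature.MathematicalPhysics.QuantumFieldTheory Literature.MathematicalPhysics.QuantumLattice
open Literature.Probability.LatticeModels (TorusSite)

namespace Summit.QuantumFields.QCD.Cruxes.StableActionBridge.TwistedTraceTransfer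

namespace StubWaveSector

/-! ### Sector bookkeeping for matrices whose entries vanish across sectors -/

section Sector

variable {F : Type*} [Fintype F] {α : Type*} (n : F → α)

/-- **Sector preservation.**  If `M_{st} = 0` whenever `n s ≠ n t`, then `M` maps vectors vanishing on
`{s | p (n s)}` to vectors vanishing there, for every predicate `p` on the sector label. [folklore] -/
theorem mulVec_apply_eq_zero_of_sector (p : α → Prop) {M : Matrix F F ℂ}
    (hM : ∀ s t, n s ≠ n t → M s t = 0) {v : F → ℂ} (hv : ∀ s, p (n s) → v s = 0) :
    ∀ s, p (n s) → (M *ᵥ v) s = 0 := by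
  intro s hs
  simp only [Matrix.mulVec, dotProduct]
  refine Finset.sum_eq_zero fun t _ => ?_
  by_cases h : n s = n t
  · rw [hv t (h ▸ hs), mul_zero]
  · rw [hM s t h, zero_mul]

/-- The product of two sector-preserving matrices is sector preserving. [folklore] -/
theorem mul_apply_eq_zero_of_sector {M N : Matrix F F ℂ} (hM : ∀ s t, n s ≠ n t → M s t = 0)
    (hN : ∀ s t, n s ≠ n t → N s t = 0) : ∀ s t, n s ≠ n t → (M * N) s t = 0 := by
  intro s t hst
  rw [Matrix.mul_apply]
  refine Finset.sum_eq_zero fun c _ => ?_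
  by_cases h : n s = n c
  · rw [hN c t (h ▸ hst), mul_zero]
  · rw [hM s c h, zero_mul]

variable [DecidableEq F]

/-- **An invertible sector-preserving matrix detects sectors**: if `det M ≠ 0`, `M_{st} = 0` for
`n s ≠ n t`, and `(M v)_s = 0` for all `s` off the sector `a₀`, then `v_s = 0` off the sector `a₀`
(split `v = v_on + v_off`; `M v_off` vanishes on the sector by sector preservation and off it because
`M v` and `M v_on` do, so `M v_off = 0` and `v_off = 0`). [folklore] -/
theorem eq_zero_off_sector_of_mulVec (a₀ : α) {M : Matrix F F ℂ} (hM : ∀ s t, n s ≠ n t → M s t = 0)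
    (hdet : M.det ≠ 0) {v : F → ℂ} (hv : ∀ s, n s ≠ a₀ → (M *ᵥ v) s = 0) :
    ∀ s, n s ≠ a₀ → v s = 0 := by
  classical
  -- the part of `v` off the sector `a₀`
  obtain ⟨w, hw⟩ : ∃ w : F → ℂ, ∀ s, w s = if n s = a₀ then 0 else v s := ⟨_, fun _ => rfl⟩
  have hoff : ∀ s, n s = a₀ → w s = 0 := fun s hs => by rw [hw, if_pos hs]
  have hon : ∀ s, n s ≠ a₀ → (v - w) s = 0 := fun s hs => by
    rw [Pi.sub_apply, hw, if_neg hs, sub_self]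
  have hMw : M *ᵥ w = 0 := by
    funext s
    by_cases hs : n s = a₀
    · exact mulVec_apply_eq_zero_of_sector n (· = a₀) hM hoff s hs
    · have h := mulVec_apply_eq_zero_of_sector n (· ≠ a₀) hM hon s hs
      rw [Matrix.mulVec_sub, Pi.sub_apply, hv s hs, zero_sub, neg_eq_zero] at h
      exact h
  have hw0 : w = 0 := Matrix.eq_zero_of_mulVec_eq_zero hdet hMw
  intro s hs
  have h := hw s
  rw [hw0, Pi.zero_apply, if_neg hs] at h
  exact h.symm

end Sector

/-! ### The stub over abstract data -/

section Abstract

variable {X : Type*} [MeasurableSpace X] {μ : Measure X}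
  {F : Type*} [Fintype F] [DecidableEq F] [MeasurableSpace F] {α : Type*} (n : F → α)

/-- **A.e. sector ⇒ everywhere sector for eigenwaves, abstract data.**  Let `R, T : X → Matrix F F ℂ`
and `B : X → X → Matrix F F ℂ` be sector preserving for the label `n`, `R(U)` invertible for every `U`,
and let `Ψ` satisfy `∫ (B(U,U') T(U') Ψ(U'))_a dμ(U') = λ Ψ(U)_a` for all `U, a` with `λ ≠ 0`.  If
`(R(U)Ψ(U))_s = 0` for `μ ⊗ count`-a.e. `(U,s)` with `n s ≠ a₀`, then `Ψ(U)_s = 0` for EVERY `U` and every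
`s` with `n s ≠ a₀`. [cite: Luscher1977, pp. 283–292] -/
theorem main_abstract {R T : X → Matrix F F ℂ} {B : X → X → Matrix F F ℂ} {Ψ : X → F → ℂ} {lam : ℂ}
    {a₀ : α} (hlam : lam ≠ 0)
    (heig : ∀ U a, ∫ U', ((B U U' * T U') *ᵥ Ψ U') a ∂μ = lam * Ψ U a)
    (hae : ∀ᵐ y ∂(μ.prod (Measure.count : Measure F)), n y.2 ≠ a₀ → (R y.1 *ᵥ Ψ y.1) y.2 = 0)
    (hRn : ∀ U s t, n s ≠ n t → R U s t = 0) (hRdet : ∀ U, (R U).det ≠ 0)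
    (hBn : ∀ U U' s t, n s ≠ n t → B U U' s t = 0) (hTn : ∀ U s t, n s ≠ n t → T U s t = 0) :
    ∀ U s, n s ≠ a₀ → Ψ U s = 0 := by
  -- Step A: from a.e. `(U,s)` to a.e. `U`, all `s` (`count` charges every `s`)
  have hA : ∀ᵐ U ∂μ, ∀ s, n s ≠ a₀ → (R U *ᵥ Ψ U) s = 0 := by
    filter_upwards [Measure.ae_ae_of_ae_prod hae] with U hU
    intro s hs
    exact Measure.ae_count_iff.1 hU s hs
  -- Step B: invert the sector-preserving `R(U)`
  have hB : ∀ᵐ U ∂μ, ∀ s, n s ≠ a₀ → Ψ U s = 0 :=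
    hA.mono fun U hU => eq_zero_off_sector_of_mulVec n a₀ (hRn U) (hRdet U) hU
  -- Step C: the eigenwave equation upgrades a.e. to everywhere
  intro U a ha
  have hz : (fun U' => ((B U U' * T U') *ᵥ Ψ U') a) =ᵐ[μ] fun _ => (0 : ℂ) :=
    hB.mono fun U' hU' =>
      mulVec_apply_eq_zero_of_sector n (· ≠ a₀) (mul_apply_eq_zero_of_sector n (hBn U U') (hTn U'))
        hU' a ha
  have h0 : lam * Ψ U a = 0 := by
    rw [← heig U a, integral_congr_ae hz, integral_zero]
  exact (mul_eq_zero.1 h0).resolve_left hlam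

end Abstract

end StubWaveSector

open StubScalarKernelProps StubModeNumberSelection StubWaveSector

/-- **Sub-goal W7a (registered stub `stub_wave_sector`): an eigenwave that vanishes a.e. off a
mode-number sector after multiplication by `R` vanishes EVERYWHERE off that sector** (and `R` itself
preserves sectors).  (i) `R(U)` commutes with `diag(#s)` (bicommutant of `T̂_F`, which conserves `#s`),
so its entries vanish across sectors and it maps sector-`m`-supported vectors to such; (ii) from
`(R(U)Ψ(U))_s = 0` for `Haar ⊗ count`-a.e. `(U,s)` with `#s ≠ n₀` one gets, for a.e. `U`, `Ψ(U)_s = 0`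
for all `#s ≠ n₀` (`count` charges every `s`; `R(U)` is invertible by `fermionSliceOp_posDef` and sector
preserving); then the eigenwave equation `λ Ψ(U) = ∫ B(U,U') T̂_F(U') Ψ(U') dU'`, whose kernel
conserves `#s`, upgrades "a.e. `U`" to "every `U`" (`λ ≠ 0`).  Instance of
`StubWaveSector.main_abstract`. [cite: Luscher1977, pp. 283–292] -/
theorem stub_wave_sector : ∀ (Nf S : ℕ) [NeZero S] (β : ℝ) (mq : Fin Nf → ℝ), (∀ f, -1 < mq f) →
    ∀ R : GaugeConfig 3 S (Matrix.specialUnitaryGroup (Fin 3) ℂ) → Matrix (Finset (SliceFermiIdx Nf S)) (Finset (SliceFermiIdx Nf S)) ℂ,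
    Continuous R → (∀ U, (R U)ᴴ = R U ∧ R U * R U = fermionSliceOp U mq ∧
        ∀ P : Matrix (Finset (SliceFermiIdx Nf S)) (Finset (SliceFermiIdx Nf S)) ℂ,
          P * fermionSliceOp U mq = fermionSliceOp U mq * P → P * R U = R U * P) →
    (∀ (U : GaugeConfig 3 S (Matrix.specialUnitaryGroup (Fin 3) ℂ)) (v : Finset (SliceFermiIdx Nf S) → ℂ) (m : ℕ),
      (∀ s : Finset (SliceFermiIdx Nf S), s.card ≠ m → v s = 0) → ∀ s : Finset (SliceFermiIdx Nf S), s.card ≠ m → (R U *ᵥ v) s = 0) ∧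
    ∀ (Ψ : SliceWave Nf S) (lam : ℝ) (n₀ : ℕ), Continuous Ψ → lam ≠ 0 →
      (∀ (U : GaugeConfig 3 S (Matrix.specialUnitaryGroup (Fin 3) ℂ)) (a : Finset (SliceFermiIdx Nf S)),
        (∫ U', (((Matrix.of fun a' c => ∫ g : TorusSite 3 S → (Matrix.specialUnitaryGroup (Fin 3) ℂ),
            (gaugeSliceKernel β U (gaugeTransform g U') : ℂ) * @fockGaugeAct Nf S _ g a' c
              ∂(Measure.pi fun _ => haarProbability (Matrix.specialUnitaryGroup (Fin 3) ℂ))) * fermionSliceOp U' mq) *ᵥ Ψ U') a ∂(sliceHaar S)) = (lam : ℂ) * Ψ U a) →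
      (∀ᵐ y ∂((sliceHaar S).prod (Measure.count : Measure (Finset (SliceFermiIdx Nf S)))),
        y.2.card ≠ n₀ → (R y.1 *ᵥ Ψ y.1) y.2 = 0) →
      ∀ (U : GaugeConfig 3 S (Matrix.specialUnitaryGroup (Fin 3) ℂ)) (s : Finset (SliceFermiIdx Nf S)), s.card ≠ n₀ → Ψ U s = 0 := by
  intro Nf S _ β mq hmq R _hRc hR
  -- the entries of `R(U)` vanish across mode-number sectors (bicommutant of `T̂_F(U)` ∋ `diag(#s)`)
  have hRn : ∀ (U : GaugeConfig 3 S (Matrix.specialUnitaryGroup (Fin 3) ℂ))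
      (s t : Finset (SliceFermiIdx Nf S)), s.card ≠ t.card → R U s t = 0 := fun U s t hst =>
    (diagonal_mul_eq_mul_diagonal_iff _ _).1 ((hR U).2.2 _ (modeNumber_comm_fermionSliceOp U mq)) s t
      fun h => hst (Nat.cast_injective h)
  refine ⟨fun U v m hv => mulVec_apply_eq_zero_of_sector Finset.card (· ≠ m) (hRn U) hv, ?_⟩
  intro Ψ lam n₀ _hΨ hlam heig hae
  -- `R(U)` is invertible: `R(U)² = T̂_F(U)` is positive definite
  have hRdet : ∀ U : GaugeConfig 3 S (Matrix.specialUnitaryGroup (Fin 3) ℂ), (R U).det ≠ 0 := by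
    intro U h
    have hpos := (Sketch.fermionSliceOp_posDef Nf S U mq hmq).det_pos
    rw [← (hR U).2.1, Matrix.det_mul, h, mul_zero] at hpos
    exact lt_irrefl _ hpos
  -- `T̂_F(U)` conserves the mode number
  have hTn : ∀ (U : GaugeConfig 3 S (Matrix.specialUnitaryGroup (Fin 3) ℂ))
      (s t : Finset (SliceFermiIdx Nf S)), s.card ≠ t.card → fermionSliceOp U mq s t = 0 := fun U s t hst =>
    (diagonal_mul_eq_mul_diagonal_iff _ _).1 (modeNumber_comm_fermionSliceOp U mq) s t
      fun h => hst (Nat.cast_injective h)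
  refine main_abstract Finset.card (Complex.ofReal_ne_zero.2 hlam) heig hae hRn hRdet ?_ hTn
  -- the bond kernel `B(U,U')` conserves the mode number (its integrand does, pointwise in `g`)
  intro U U' s t hst
  rw [Matrix.of_apply]
  simp only [fockGaugeAct_apply_of_card_ne _ hst, mul_zero, integral_zero]

end Summit.QuantumFields.QCD.Cruxes.StableActionBridge.TwistedTraceTransfer

end
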